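import Summits.Ventures.HodgeRepro2.T5AveragedProjection
import Summits.Ventures.HodgeRepro2.T5SchurMathlib
import Summits.Ventures.HodgeRepro2.T5RestrictionRep

/-!
# Weights: continuous representations of compact abelian groups are sums of lines

Blind cell `pub-hodge-repro2`, seat p1 (gen 12), Tier-5 kernel support for the S4.7 row «the weights of
SO(2)» (P2′: «the SO(2)-weights are exactly {3, 5, 7, …}, each once» — read as a statement about the
decomposition of a representation of the compact ABELIAN group SO(2) into one-dimensional stable lines,
each carrying a continuous character, the «weight»).

* `finrank_eq_one_of_isIrreducibleSubspace` — over a commutative group every irreducible stable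
  subspace is a line (Mathlib `Representation.IsIrreducible.finrank_eq_one_of_isMulCommutative`, Schur
  over the algebraically closed `ℂ`);
* `exists_decomposition_finrank_eq_one` — **every continuous finite-dimensional representation of a
  compact abelian group is an internal direct sum of stable lines** (the averaged-projection
  decomposition of `T5AveragedProjection`, no unitarity);
* `weight` — the **weight** of a stable line spanned by `w ≠ 0`: `π g w = weight g • w`;
  `weight_one`, `weight_mul` (a homomorphism `G → ℂ`), `weight_ne_zero`, `continuous_weight`
  (`weight g = ⟪w, π g w⟫ / ⟪w, w⟫`, a matrix coefficient), and `weightHom : G →* ℂˣ`.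

Print: Goodman–Wallach GTM 255 §4.3.2 (Corollary of Schur's lemma for abelian groups) / §7.3.4 p. 360.
Honest scope (unchanged): compact groups and finite-dimensional representations; the SO(2)-weights of
the INFINITE-dimensional π₃⁺ are not an instance of these statements.
-/

namespace Summit.Ventures.HodgeRepro2.T5AbelianWeights

open MeasureTheory T5SchurOrthogonality T5CompleteReducibility T5RestrictionRep T5SchurMathlib

variable {G : Type*} [Group G]
variable {V : Type*} [NormedAddCommGroup V] [InnerProductSpace ℂ V]
variable (π : G →* V →L[ℂ] V)

section lines

variable [FiniteDimensional ℂ V] [IsMulCommutative G]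

/-- Over a commutative group every irreducible stable subspace is one-dimensional (Schur's lemma over
`ℂ`, Mathlib `Representation.IsIrreducible.finrank_eq_one_of_isMulCommutative`). -/
theorem finrank_eq_one_of_isIrreducibleSubspace {W : Submodule ℂ V} (hW : IsIrreducibleSubspace π W) :
    Module.finrank ℂ W = 1 := by
  haveI : Nontrivial W := nontrivial_of_isIrreducibleSubspace π W hW
  haveI : (toRep (restrictRep π W hW.2.1)).IsIrreducible :=
    (isIrreducible_iff _).mp (isIrreducible_restrictRep π W hW _)
  exact Representation.IsIrreducible.finrank_eq_one_of_isMulCommutative (toRep (restrictRep π W hW.2.1))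

variable [TopologicalSpace G] [IsTopologicalGroup G] [MeasurableSpace G] [BorelSpace G]
  [CompactSpace G]

/-- **Every continuous finite-dimensional representation of a compact abelian group is an internal
direct sum of stable lines** (no unitarity: the averaged-projection decomposition). -/
theorem exists_decomposition_finrank_eq_one (μ : Measure G) [IsProbabilityMeasure μ]
    [μ.IsMulLeftInvariant] (hπ : Continuous π) :
    ∃ S : Finset (Submodule ℂ V),
      (∀ W ∈ S, IsIrreducibleSubspace π W ∧ Module.finrank ℂ W = 1) ∧
        DirectSum.IsInternal (fun W : S => (W : Submodule ℂ V)) := by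
  obtain ⟨S, hS, hint⟩ := T5AveragedProjection.exists_isInternal_irreducible μ π hπ
  exact ⟨S, fun W hW => ⟨hS W hW, finrank_eq_one_of_isIrreducibleSubspace π (hS W hW)⟩, hint⟩

end lines

section weight

variable {W : Submodule ℂ V} (hW : IsStable π W) (h1 : Module.finrank ℂ W = 1)
variable {w : V} (hw : w ∈ W) (hw0 : w ≠ 0)

include hW h1 hw hw0 in
/-- On a stable line spanned by `w ≠ 0`, every `π g` acts by a scalar. -/
theorem exists_smul_eq (g : G) : ∃ c : ℂ, π g w = c • w := by
  have hne : (⟨w, hw⟩ : W) ≠ 0 := fun h => hw0 (congrArg Subtype.val h)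
  obtain ⟨c, hc⟩ := (finrank_eq_one_iff_of_nonzero' (⟨w, hw⟩ : W) hne).mp h1 ⟨π g w, hW g w hw⟩
  refine ⟨c, ?_⟩
  have := congrArg Subtype.val hc
  simpa using this.symm

/-- The **weight** of the stable line spanned by `w`: the scalar by which `π g` acts. -/
noncomputable def weight (g : G) : ℂ := Classical.choose (exists_smul_eq π hW h1 hw hw0 g)

/-- `π g w = weight g • w`. -/
theorem weight_spec (g : G) : π g w = weight π hW h1 hw hw0 g • w :=
  Classical.choose_spec (exists_smul_eq π hW h1 hw hw0 g)

include hw0 in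
/-- The weight is determined by its action on `w`. -/
theorem weight_eq_of_smul_eq {g : G} {c : ℂ} (h : π g w = c • w) : weight π hW h1 hw hw0 g = c :=
  smul_left_injective ℂ hw0 ((weight_spec π hW h1 hw hw0 g).symm.trans h)

/-- `weight 1 = 1`. -/
theorem weight_one : weight π hW h1 hw hw0 1 = 1 :=
  weight_eq_of_smul_eq π hW h1 hw hw0 (by rw [map_one, one_apply_eq_self, one_smul])

/-- The weight is multiplicative. -/
theorem weight_mul (g h : G) :
    weight π hW h1 hw hw0 (g * h) = weight π hW h1 hw hw0 g * weight π hW h1 hw hw0 h :=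
  weight_eq_of_smul_eq π hW h1 hw hw0 (by
    rw [map_mul, mul_apply_eq_comp, weight_spec π hW h1 hw hw0 h, map_smul,
      weight_spec π hW h1 hw hw0 g, smul_smul, mul_comm])

/-- The weight is never zero (`π g` is invertible). -/
theorem weight_ne_zero (g : G) : weight π hW h1 hw hw0 g ≠ 0 := by
  intro h0
  have h := weight_spec π hW h1 hw hw0 g
  rw [h0, zero_smul] at h
  have := congrArg (π g⁻¹) h
  rw [map_zero, ← mul_apply_eq_comp, ← map_mul, inv_mul_cancel, map_one, one_apply_eq_self] at this
  exact hw0 this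

/-- The weight as a homomorphism `G →* ℂˣ`. -/
noncomputable def weightHom : G →* ℂˣ where
  toFun g := Units.mk0 _ (weight_ne_zero π hW h1 hw hw0 g)
  map_one' := by ext; simp [weight_one]
  map_mul' g h := by ext; simp [weight_mul]

/-- `weightHom g = weight g` as complex numbers. -/
theorem coe_weightHom_apply (g : G) : (weightHom π hW h1 hw hw0 g : ℂ) = weight π hW h1 hw hw0 g :=
  rfl

/-- The weight is the matrix coefficient `⟪w, π g w⟫ / ⟪w, w⟫`. -/
theorem weight_eq_inner_div (g : G) :
    weight π hW h1 hw hw0 g = inner ℂ w (π g w) / inner ℂ w w := by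
  rw [weight_spec π hW h1 hw hw0 g, inner_smul_right, mul_div_assoc,
    div_self (inner_self_ne_zero.mpr hw0), mul_one]

/-- The weight of a continuous representation is continuous. -/
theorem continuous_weight [TopologicalSpace G] (hπ : Continuous π) :
    Continuous (weight π hW h1 hw hw0) := by
  have : weight π hW h1 hw hw0 = fun g => inner ℂ w (π g w) / inner ℂ w w :=
    funext (weight_eq_inner_div π hW h1 hw hw0)
  rw [this]
  exact (continuous_matrixCoefficient π hπ w w).div_const _

end weight

end Summit.Ventures.HodgeRepro2.T5AbelianWeights
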